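import Summits.AtomisticToContinuum.BoseEinsteinCondensation.Theorems.BECThomsonPrincipleGDTransferDefs
import Summits.AtomisticToContinuum.BoseEinsteinCondensation.Theorems.BECThomsonPrincipleGDTransferModeCounting
import Summits.AtomisticToContinuum.BoseEinsteinCondensation.Theorems.BECThomsonPrincipleGDTransferWindowLaw
import Summits.AtomisticToContinuum.BoseEinsteinCondensation.Theorems.BECThomsonPrincipleGDTransferChordVariation
import Summits.AtomisticToContinuum.BoseEinsteinCondensation.Theorems.BECThomsonPrincipleGDTransferLnssAlgebra
import Summits.AtomisticToContinuum.BoseEinsteinCondensation.Theorems.BECThomsonPrincipleGDTransferDressedWitnessReduction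

/-!
# Line `dyson-dressed-witness` for the crux `GDTransfer` (stmt-AtomisticToContinuum-9482) — SKELETON v3 (lead, 2026-08-16)

v3 = v2 with the LANDED parts imported instead of restated.  The vocabulary, the seven registered signatures
`Sig.stub_*` and the sorry-free composition `GDTransfer_of` live in `Theorems/BECThomsonPrincipleGDTransferDefs.lean`
(p85002); the registered stubs `stub_modeCounting` (p85943), `stub_windowLaw` (p93569), `stub_chordVariation` (p91537,
helpers p89502/p90160/p90875), `stub_lnssAlgebra` (p93407, helpers p92592/p92966/p93276), `stub_bareAdmissible` (helpers p94669/p94808 + Ops + main, worker) are theorems in tree;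
the true parts of the bare second variation (slot derivatives, `[∇,Λ†]`, `[∇,Λ]`, adjointness, the exact kinetic identity
`t(f,Λ†g) − t(Λf,g) = |k|²⟨f,Λ†g⟩`) are in `…BareSecondVariation{SlotDeriv,Commutators,Kinetic}` (p94640/p94790/p95045); the
hardest stub is reduced in tree to `RelativeDefectPairFor` (`dwf_of_relativeDefect`, p93820).  `sorry` remains exactly in
the TWO registered stubs that are NOT landed (both crux-sized — the line is DEAD, see Lines/dyson-dressed-witness-dead.md;
plus a placeholder for the landed `stub_bareAdmissible`, see its docstring):

* `stub_bareSecondVariation` — CRUX-SIZED ("SecondVariationAPriori"): the interaction part of the KLS second variation is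
  state-dependent in the continuum (family `φ^{⊗N}` with `|α|² = 1/N`: `𝒟^V ≈ 0.23 √N ρ‖v‖₁` at `W ≈ 0.64`, exact Fock
  computation, crux evidence); the registered near-minimiser form is an a-priori ground-state bound no Leans-on supplies;
* `stub_dressedWitness` — CRUX-SIZED a fortiori (non-integrable `v`: `RelativeDefectPairFor v`, crux evidence ANALYSIS).

`GDTransfer_closed` shows the crux BY NAME from the landed theorems and the two remaining registered stubs.
-/

noncomputable section

namespace Summit.AtomisticToContinuum.BoseEinsteinCondensation.Cruxes.GDTransfer.DysonDressedWitness

open Summit.AtomisticToContinuum.BoseEinsteinCondensation.Theses.BECThomsonPrinciple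

/-- Registered stub 5 — LANDED in tree as `…Theorems.BECThomsonPrincipleGDTransferBareAdmissible.stub_bareAdmissible`
(p95274, 2026-08-16T09:57Z); kept here as a local placeholder ONLY because the check farm had not yet built that module when
this skeleton was published (`remote:stale:unbuilt`); replace this block by
`import Summits.AtomisticToContinuum.BoseEinsteinCondensation.Theorems.BECThomsonPrincipleGDTransferBareAdmissible`. -/
theorem stub_bareAdmissible : Sig.stub_bareAdmissible := by
  sorry

/-- Registered stub 6 — the bare second variation at near-minimisers (BLOCKED: SecondVariationAPriori; crux-sized and
circular for the typed crux — see Lines/dyson-dressed-witness-dead.md). -/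
theorem stub_bareSecondVariation : Sig.stub_bareSecondVariation := by
  sorry

/-- Registered stub 7 — the dressed core-safe witness family for non-integrable `v` (CRUX-SIZED; reduced to
`RelativeDefectPairFor` by `dwf_of_relativeDefect`). -/
theorem stub_dressedWitness : Sig.stub_dressedWitness := by
  sorry

/-- **The crux BY NAME from the landed stubs and the two remaining registered ones.** -/
theorem GDTransfer_closed : GDTransfer :=
  GDTransfer_of stub_modeCounting stub_windowLaw stub_chordVariation stub_lnssAlgebra stub_bareAdmissible
    stub_bareSecondVariation stub_dressedWitness

end Summit.AtomisticToContinuum.BoseEinsteinCondensation.Cruxes.GDTransfer.DysonDressedWitness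

end
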